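import Summits.BirchSwinnertonDyer.BirchSwinnertonDyer.Theses.UniversalToricDescent
import Summits.BirchSwinnertonDyer.BirchSwinnertonDyer.Theorems.EisensteinPrimesHidaLimitFittingBoundConverse
import Summits.BirchSwinnertonDyer.Rank1Residual.X11b.BDPRouteOpenInputDegenerateFrame
import Literature.NumberTheory.EllipticCurves.CyclotomicIwasawaMainTheoremIrreducibleProofs
import Mathlib.RingTheory.PowerSeries.Derivative
import HarnessLib

/-!
# NODE (D-0171) on crux stmt-BirchSwinnertonDyer-24207 `UniversalToricDescent.RationalSplitIMCInclusionAtThree`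
# — idea `root-trichotomy-rank-cap` (crux-ideate seat `cruxidea-stmt-BirchSwinnertonDyer-24207-1` gen 6, 2026-08-30)

KIND: REDUCTION (EQUIV, by root type) + two NEGATIVE lemmas (supply side).  Since every `3`-power is invisible to the
crux (`∃ k, 3ᵏ·L ∈ Ch_Λ(X_(∅,0))·R₀⟦T⟧`, `R₀⟦T⟧[1/3]` a PID after Weierstrass), the wall is EXACTLY a root-wise
statement on the open unit disc `D = {x ∈ ℂ₃ : ‖x‖ < 1}` (`x = ψ(γ) − 1`):  `ord_x L ≥ ord_x F` for a generator `F`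
of `Ch_Λ(X_(∅,0))·R₀⟦T⟧` and every `x ∈ D` (piece **R**, Weierstrass division; converse **Rc**).  The points of `D`
come in three kinds and the wall splits accordingly:

* **A — classical simple part** (`x = ζ − 1`, `ζ ∈ μ_{3^∞}`, order `1`): `F(ζ−1) = 0 ⟹ L(ζ−1) = 0`.  PRINT-ATTACKABLE and
  NORMALISATION-FREE (only zero / non-zero of a special value is used, so the un-printed toric local factor at the
  additive prime — the K1 obstruction of `universal-toric-half-order` — is irrelevant): `F(ζ−1)=0` ⟹ (control for
  `(∅,0)` at layer `m`, bounded kernel/cokernel since `E[3](K_∞)=0` under `ρ̄₃` onto) `Sel_(∅,0)(K_m)^{χ_ζ}` infinite ⟹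
  (twisted Kolyvagin: Nekovář 2007 Thm. 3.2 / Howard 2004, rational statement, any reduction type at `p` once `ρ̄`
  is irreducible; `loc_{𝔭'}` of a non-torsion point is non-torsion) the `χ_ζ`-Heegner point `P_{χ_ζ}` is torsion ⟹
  (`p`-adic Waldspurger at the finite-order character `χ_ζ`, OUTSIDE the interpolation range, for ARBITRARY `π₃` with
  `3` split in `K`: Liu–Zhang–Zhang 2018 Thm. 1.8; BDP 2013 Thm. 5.13 at `p ∤ N`) `L(ζ−1) = c_ζ · log_𝔭(P_{χ_ζ})² = 0`.
* **B — classical higher multiplicity** (`ord_{ζ−1} F ≥ 2`): UNDECIDED.  Leaves: INSTRUMENTABLE (D-g6-1: first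
  `T`-derivative of `L^{BDP}` at the classical roots of the three smallest O6 rows — are there multiple classical roots
  at all?) and IDEA-NEEDED (a second-order `p`-adic Waldspurger formula: `L'(ζ−1)` ↔ the anticyclotomic `3`-adic
  height `⟨P_χ, P_{χ̄}⟩`, non-degenerate off `χ = 𝟙`; cf. barrier `AnticyclotomicHeightDegeneracy` at `χ = 𝟙`, where
  `L(0) = log_𝔭(y_K)² ≠ 0` and nothing is asked).
* **C — non-classical roots** (`1+x ∉ μ_{3^∞}`): UNDECIDED · IDEA-NEEDED, fenced by two NEW negative lemmas and the
  catalogued barriers: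
  (N1, toric multiplicity one ⟹ RANK CAP) `dim Hom_{K_v^×}(π_v, χ_v) ≤ 1` at every place (Waldspurger, Saito–Tunnell;
  YZZ Thm. 1.2) makes every `χ`-isotypic piece of the module generated by ALL CM points of `3`-power conductor at most
  one-dimensional, so the `Frac(Λ)⊗𝓗`-span of every CM-sourced anticyclotomic family (any conductor, test vector or
  tempered normalisation) inside `ℍ¹ = H¹_{Iw,(∅,∅)}` (Λ-rank 2) has rank ≤ 1: the second generator that the
  `(∅,0)`-wall needs on the SC rows (no local line at `3`, B-g5-6) is NOT a CM object — whatever its order of growth;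
  (N2, LINE INCIDENCE) in `Spec Λ_K` (`Γ_K = Γ_𝔭 × Γ_{𝔭'} ≅ ℤ₃²`) the lines carrying an INTEGRAL Euler system with
  `f_E` fixed supercuspidal are the `𝔭`-axis and its torsion translates (Beilinson–Flach against the `𝔭`-ordinary CM
  family: the thin comb of the LEAD / `axis-carrier`, `thin-comb-reflection` on 20395), their complex conjugates, and
  the cyclotomic diagonal (Kato for `f_E` and `f_E ⊗ ε_K`: `nakayama-anchor` on 20395); each meets the anticyclotomic
  anti-diagonal `{(κ, κ⁻¹)}` only at CLASSICAL points (`(ζ̄, ζ)`) or at the origin.  Hence no integral line ever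
  passes through a non-classical point of the wall: piece C is reachable only through two-variable Zariski density from
  the comb with `3`-power slack UNIFORM in the tooth — which is the LEAD's `stub_ratCombDvdUpTo2` / 24207 itself — or
  through a non-CM rank-two motive (host cards of 20395).  Catalogued: `TraceZeroHeegnerTowerAtAdditiveSplitP` (order
  exactly 1 ⟹ no germ / no value of the tempered Heegner coset at non-classical `x`, B-g5-4), `NoAdmissiblePrimesAtThree`.

COMPOSITION (kernel, BY NAME): `R → A → B → C → RationalSplitIMCInclusionAtThree` (torsion dichotomy as in the gen-3/4/5
nodes; for `x ∈ D` classical the order-`1` case is **A**, order `≥ 2` is **B**, non-classical is **C**; **R** turns the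
root-wise inequality into the ideal membership).  Honours: K1 (no bounded toric family is posited), B-g4-1, B-g5-4, B-g5-9
(no germ, no twisted descent), `NoAdmissiblePrimesAtThree` (no level raising), the negatives index (15532, 24881 unrelated).
No `Disproof.lean` is on file for this crux.

KEEP/KILL of the live ideas, the new barrier notes B-g6-1…B-g6-6 and the instrument asks: `HANDOFF-cruxidea-24207-1-g6.md`.
References: LiuZhangZhang2018 (Duke 167) Thm. 1.8; BertoliniDarmonPrasanna2013 Thm. 5.13; Nekovar2007 (Heegner points
and Kolyvagin's method for twisted characters) Thm. 3.2; Howard2004 (Compositio 140); YuanZhangZhang2013 Thm. 1.2 and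
§1.2 (Saito–Tunnell); Kato2004 Thm. 12.5; LeiLoefflerZerbes2015 (arXiv:1311.0175); Washington GTM 83 §7.1; Lazard 1962.
-/

set_option linter.dupNamespace false

open scoped Classical

namespace Summit.BirchSwinnertonDyer.BirchSwinnertonDyer.Cruxes.RationalSplitIMCInclusionAtThree.RootTrichotomyRankCap

open PowerSeries Literature.NumberTheory.EllipticCurves Summit.BirchSwinnertonDyer.Rank1Residual.X11b

/-- A classical point of the open disc: `x = ζ − 1` with `ζ ∈ μ_{3^∞}` (a finite-order character of `Γ^{ac}`). -/
def IsClassicalPoint (x : ℂ_[3]) : Prop := ∃ m : ℕ, (1 + x) ^ (3 ^ m) = 1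

/-- `G` vanishes to order `≥ n` at the point `x` of the open disc: `G^{(i)}(x) = 0` for `i < n` (formal derivatives
over `R₀`, values via the tree's `UnrSeries.HasValueAt`; characteristic `0`, so ordinary derivatives suffice). -/
def VanishesToOrder (G : UnrSeries 3) (x : ℂ_[3]) (n : ℕ) : Prop :=
  ∀ i < n, ((fun H : UnrSeries 3 ↦ PowerSeries.derivative (unrIntegers 3) H)^[i] G).HasValueAt x 0

/-- The root-wise order inequality `ord_x L ≥ ord_x F` on the open unit disc of `ℂ₃`. -/
def RootwiseDominates (F L : UnrSeries 3) : Prop :=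
  ∀ x : ℂ_[3], ‖x‖ < 1 → ∀ n : ℕ, VanishesToOrder F x n → VanishesToOrder L x n

/-- **R [WEAKER · ATTACKABLE (M)]** the root-wise door: if `L` vanishes wherever `F ≠ 0` does, with multiplicity, on
the open disc, then `F ∣ 3ᵏ·L` in `R₀⟦T⟧` — Weierstrass preparation `F = 3^μ·P·u` and division by the distinguished
`P` (remainder a polynomial of degree `< deg P` vanishing at all roots of `P` with multiplicity, hence `0`); `k = μ`.
[Washington GTM 83 §7.1; Lazard 1962] -/
def RootwiseDoor : Prop :=
  ∀ F L : UnrSeries 3, F ≠ 0 → RootwiseDominates F L → ∃ k : ℕ, ((3 : ℕ) : UnrSeries 3) ^ k * L ∈ Ideal.span {F}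

/-- **Rc [WEAKER · ATTACKABLE (S) · ASIDE — evidence for EQUIV]** the converse: `3ᵏ·L = F·H` ⟹ `ord_x L ≥ ord_x F`
(Leibniz).  Not used by the composition. -/
def RootwiseDoorConverse : Prop :=
  ∀ F L : UnrSeries 3, (∃ k : ℕ, ((3 : ℕ) : UnrSeries 3) ^ k * L ∈ Ideal.span {F}) → RootwiseDominates F L

/-- **A [WEAKER · ATTACKABLE (print)]** classical simple roots transfer: on the wall's binders, with `X_(∅,0)` torsion
and `Ch_Λ(X_(∅,0))·R₀⟦T⟧ = (F)`, every classical root of `F` is a root of `L`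
(control ⟹ twisted Kolyvagin ⟹ `P_χ` torsion ⟹ `p`-adic Waldspurger `L(χ) = c·log_𝔭(P_χ)² = 0`; zero/non-zero only). -/
def ClassicalSimpleRootTransferAtThree : Prop :=
  ∀ (W : WeierstrassCurve ℚ) [W.IsElliptic] [W.IsGloballyMinimal] (N : ℕ) [NeZero N] (K : Type) [Field K] [NumberField K] (Dt : Literature.NumberTheory.EllipticCurves.ModularForms.ModularParametrizationData W N), Summit.BirchSwinnertonDyer.Rank1Residual.Additive.ClassO6 W 3 → W.HasSurjectiveModNGaloisRep 3 → W.analyticRank = 1 → W.conductorNorm ℤ = N → Literature.NumberTheory.EllipticCurves.IsImaginaryQuadratic K → Literature.NumberTheory.EllipticCurves.SatisfiesHeegnerHypothesis N K → ∀ (κ : Literature.NumberTheory.EllipticCurves.ZpExtension K 3), κ.IsAnticyclotomic → ∀ (γ : Field.absoluteGaloisGroup K) [Fact (κ.IsTopGenerator γ)] (𝔭 : IsDedekindDomain.HeightOneSpectrum (NumberField.RingOfIntegers K)), ((3 : ℕ) : NumberField.RingOfIntegers K) ∈ 𝔭.asIdeal → 𝔭.asIdeal.ramificationIdx (NumberField.RingOfIntegers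 ℚ) = 1 → 𝔭.asIdeal.inertiaDeg (NumberField.RingOfIntegers ℚ) = 1 → ∀ (𝔭' : IsDedekindDomain.HeightOneSpectrum (NumberField.RingOfIntegers K)), ((3 : ℕ) : NumberField.RingOfIntegers K) ∈ 𝔭'.asIdeal → 𝔭' ≠ 𝔭 → ∀ (ι' : PadicAlgCl 3 ≃+* ℂ), Summit.BirchSwinnertonDyer.BirchSwinnertonDyer.Theorems.SchneiderFree.BranchInducesPrime 3 ι' 𝔭 → ∀ (ΩK : ℂ) (Ωp : ℂ_[3]) (L : Literature.NumberTheory.EllipticCurves.UnrSeries 3), ΩK ≠ 0 → Ωp ≠ 0 → Literature.NumberTheory.EllipticCurves.IsBDPLFunction ι' 𝔭 κ γ Dt.f ΩK Ωp L → Module.IsTorsion (Literature.NumberTheory.EllipticCurves.IwasawaAlgebra 3) (Summit.BirchSwinnertonDyer.Rank1Residual.X11b.AcSelmer.XAc (W.baseChange K) 3 κ 𝔭' ∅ γ) → ∀ F : Literature.NumberTheory.EllipticCurves.UnrSeries 3, (Summit.BirchSwinnertonDyer.Rank1Residual.X11b.AcSelmer.XAc.charIdeal (W.baseChange K) 3 κ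 𝔭' ∅ γ).map (PowerSeries.map (Summit.BirchSwinnertonDyer.Rank1Residual.X11b.Halves.toUnr 3)) = Ideal.span {F} →
    ∀ x : ℂ_[3], ‖x‖ < 1 → IsClassicalPoint x → VanishesToOrder F x 1 → VanishesToOrder L x 1

/-- **B [UNDECIDED · INSTRUMENTABLE (D-g6-1) · IDEA-NEEDED (second-order `p`-adic Waldspurger ↔ anticyclotomic
height)]** classical higher multiplicities transfer: `ord_{ζ−1} F = n ≥ 2 ⟹ ord_{ζ−1} L ≥ n`. -/
def ClassicalMultiplicityTransferAtThree : Prop :=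
  ∀ (W : WeierstrassCurve ℚ) [W.IsElliptic] [W.IsGloballyMinimal] (N : ℕ) [NeZero N] (K : Type) [Field K] [NumberField K] (Dt : Literature.NumberTheory.EllipticCurves.ModularForms.ModularParametrizationData W N), Summit.BirchSwinnertonDyer.Rank1Residual.Additive.ClassO6 W 3 → W.HasSurjectiveModNGaloisRep 3 → W.analyticRank = 1 → W.conductorNorm ℤ = N → Literature.NumberTheory.EllipticCurves.IsImaginaryQuadratic K → Literature.NumberTheory.EllipticCurves.SatisfiesHeegnerHypothesis N K → ∀ (κ : Literature.NumberTheory.EllipticCurves.ZpExtension K 3), κ.IsAnticyclotomic → ∀ (γ : Field.absoluteGaloisGroup K) [Fact (κ.IsTopGenerator γ)] (𝔭 : IsDedekindDomain.HeightOneSpectrum (NumberField.RingOfIntegers K)), ((3 : ℕ) : NumberField.RingOfIntegers K) ∈ 𝔭.asIdeal → 𝔭.asIdeal.ramificationIdx (NumberField.RingOfIntegers ℚ) = 1 → 𝔭.asIdeal.inertiaDeg (NumberField.RingOfIntegers ℚ) = 1 → ∀ (𝔭' : IsDedekindDomain.HeightOneSpectrum (NumberField.RingOfIntegers K)), ((3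 : ℕ) : NumberField.RingOfIntegers K) ∈ 𝔭'.asIdeal → 𝔭' ≠ 𝔭 → ∀ (ι' : PadicAlgCl 3 ≃+* ℂ), Summit.BirchSwinnertonDyer.BirchSwinnertonDyer.Theorems.SchneiderFree.BranchInducesPrime 3 ι' 𝔭 → ∀ (ΩK : ℂ) (Ωp : ℂ_[3]) (L : Literature.NumberTheory.EllipticCurves.UnrSeries 3), ΩK ≠ 0 → Ωp ≠ 0 → Literature.NumberTheory.EllipticCurves.IsBDPLFunction ι' 𝔭 κ γ Dt.f ΩK Ωp L → Module.IsTorsion (Literature.NumberTheory.EllipticCurves.IwasawaAlgebra 3) (Summit.BirchSwinnertonDyer.Rank1Residual.X11b.AcSelmer.XAc (W.baseChange K) 3 κ 𝔭' ∅ γ) → ∀ F : Literature.NumberTheory.EllipticCurves.UnrSeries 3, (Summit.BirchSwinnertonDyer.Rank1Residual.X11b.AcSelmer.XAc.charIdeal (W.baseChange K) 3 κ 𝔭' ∅ γ).map (PowerSeries.map (Summit.BirchSwinnertonDyer.Rank1Residual.X11b.Halves.toUnr 3)) = Ideal.span {F} →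
    ∀ x : ℂ_[3], ‖x‖ < 1 → IsClassicalPoint x → ∀ n : ℕ, 2 ≤ n → VanishesToOrder F x n → VanishesToOrder L x n

/-- **C [UNDECIDED · IDEA-NEEDED · BARRIER (N1 toric rank cap, N2 line incidence, `TraceZeroHeegnerTowerAtAdditiveSplitP`,
`NoAdmissiblePrimesAtThree`)]** non-classical roots transfer: for `1 + x ∉ μ_{3^∞}`, `ord_x L ≥ ord_x F`. -/
def NonClassicalRootTransferAtThree : Prop :=
  ∀ (W : WeierstrassCurve ℚ) [W.IsElliptic] [W.IsGloballyMinimal] (N : ℕ) [NeZero N] (K : Type) [Field K] [NumberField K] (Dt : Literature.NumberTheory.EllipticCurves.ModularForms.ModularParametrizationData W N), Summit.BirchSwinnertonDyer.Rank1Residual.Additive.ClassO6 W 3 → W.HasSurjectiveModNGaloisRep 3 → W.analyticRank = 1 → W.conductorNorm ℤ = N → Literature.NumberTheory.EllipticCurves.IsImaginaryQuadratic K → Literature.NumberTheory.EllipticCurves.SatisfiesHeegnerHypothesis N K → ∀ (κ : Literature.NumberTheory.EllipticCurves.ZpExtension K 3), κ.IsAnticyclotomic → ∀ (γ : Field.absoluteGaloisGroup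 K) [Fact (κ.IsTopGenerator γ)] (𝔭 : IsDedekindDomain.HeightOneSpectrum (NumberField.RingOfIntegers K)), ((3 : ℕ) : NumberField.RingOfIntegers K) ∈ 𝔭.asIdeal → 𝔭.asIdeal.ramificationIdx (NumberField.RingOfIntegers ℚ) = 1 → 𝔭.asIdeal.inertiaDeg (NumberField.RingOfIntegers ℚ) = 1 → ∀ (𝔭' : IsDedekindDomain.HeightOneSpectrum (NumberField.RingOfIntegers K)), ((3 : ℕ) : NumberField.RingOfIntegers K) ∈ 𝔭'.asIdeal → 𝔭' ≠ 𝔭 → ∀ (ι' : PadicAlgCl 3 ≃+* ℂ), Summit.BirchSwinnertonDyer.BirchSwinnertonDyer.Theorems.SchneiderFree.BranchInducesPrime 3 ι' 𝔭 → ∀ (ΩK : ℂ) (Ωp : ℂ_[3]) (L : Literature.NumberTheory.EllipticCurves.UnrSeries 3), ΩK ≠ 0 → Ωp ≠ 0 → Literature.NumberTheory.EllipticCurves.IsBDPLFunction ι' 𝔭 κ γ Dt.f ΩK Ωp L → Module.IsTorsion (Literature.NumberTheory.EllipticCurves.IwasawaAlgebra 3) (Summit.BirchSwinnertonDyer.Rank1Residual.X11b.AcSelmer.XAc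 (W.baseChange K) 3 κ 𝔭' ∅ γ) → ∀ F : Literature.NumberTheory.EllipticCurves.UnrSeries 3, (Summit.BirchSwinnertonDyer.Rank1Residual.X11b.AcSelmer.XAc.charIdeal (W.baseChange K) 3 κ 𝔭' ∅ γ).map (PowerSeries.map (Summit.BirchSwinnertonDyer.Rank1Residual.X11b.Halves.toUnr 3)) = Ideal.span {F} →
    ∀ x : ℂ_[3], ‖x‖ < 1 → ¬ IsClassicalPoint x → ∀ n : ℕ, VanishesToOrder F x n → VanishesToOrder L x n

/-- Vanishing to order `0` is no condition. -/
theorem vanishesToOrder_zero (G : UnrSeries 3) (x : ℂ_[3]) : VanishesToOrder G x 0 :=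
  fun i hi ↦ absurd hi (Nat.not_lt_zero i)

/-- The extended characteristic ideal is principal: `Ch_Λ(X)·R₀⟦T⟧ = (F)` (verbatim from the gen-3/4/5 nodes). -/
theorem exists_map_charIdeal_eq_span {K : Type} [Field K] [NumberField K] (W : WeierstrassCurve K)
    (κ : ZpExtension K 3) (𝔭' : IsDedekindDomain.HeightOneSpectrum (NumberField.RingOfIntegers K))
    (γ : Field.absoluteGaloisGroup K) [Fact (κ.IsTopGenerator γ)] :
    ∃ F : UnrSeries 3, (AcSelmer.XAc.charIdeal W 3 κ 𝔭' ∅ γ).map (PowerSeries.map (Halves.toUnr 3)) =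
      Ideal.span {F} := by
  obtain ⟨f, hf⟩ := (charIdeal_isPrincipal_holds 3 (AcSelmer.XAc W 3 κ 𝔭' ∅ γ)).principal
  refine ⟨PowerSeries.map (Halves.toUnr 3) f, ?_⟩
  have hf' : AcSelmer.XAc.charIdeal W 3 κ 𝔭' ∅ γ = Ideal.span {f} := by
    change Literature.NumberTheory.EllipticCurves.Module.charIdeal (IwasawaAlgebra 3) (AcSelmer.XAc W 3 κ 𝔭' ∅ γ) =
      Ideal.span {f}
    simpa [Ideal.submodule_span_eq] using hf
  rw [hf', Ideal.map_span, Set.image_singleton]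

/-- The extended characteristic ideal is nonzero (`Ch_Λ ≠ ⊥` over a domain, `Λ → R₀⟦T⟧` injective). -/
theorem map_charIdeal_ne_bot {K : Type} [Field K] [NumberField K] (W : WeierstrassCurve K)
    (κ : ZpExtension K 3) (𝔭' : IsDedekindDomain.HeightOneSpectrum (NumberField.RingOfIntegers K))
    (γ : Field.absoluteGaloisGroup K) [Fact (κ.IsTopGenerator γ)] :
    (AcSelmer.XAc.charIdeal W 3 κ 𝔭' ∅ γ).map (PowerSeries.map (Halves.toUnr 3)) ≠ ⊥ := by
  rw [Ne, Ideal.map_eq_bot_iff_of_injective map_toUnr_injective]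
  exact Literature.NumberTheory.EllipticCurves.Module.charIdeal_ne_bot (IwasawaAlgebra 3) _

/-- **The idea's composition (kernel, BY NAME): R ∧ A ∧ B ∧ C ⟹ 24207.**  On the wall's binders: if `X_(∅,0)` is not
Λ-torsion its characteristic ideal is `⊤` and `k = 0` works; otherwise `Ch·R₀⟦T⟧ = (F)` with `F ≠ 0`, and for every
`x` in the open disc the order inequality is **A** (classical, order 1), **B** (classical, order ≥ 2) or **C**
(non-classical); **R** converts it into `F ∣ 3ᵏ·L`. -/
theorem rationalSplitIMCInclusionAtThree_of_rootTrichotomy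
    (hR : RootwiseDoor) (hA : ClassicalSimpleRootTransferAtThree) (hB : ClassicalMultiplicityTransferAtThree)
    (hC : NonClassicalRootTransferAtThree) :
    Summit.BirchSwinnertonDyer.BirchSwinnertonDyer.Theses.UniversalToricDescent.RationalSplitIMCInclusionAtThree := by
  intro W _ _ N _ K _ _ Dt hO6 hsurj hr1 hN hK hH κ hκ γ _ 𝔭 h𝔭 he hf 𝔭' h𝔭' hne ι' hι ΩK Ωp L hΩK hΩp hL
  by_cases htor : Module.IsTorsion (IwasawaAlgebra 3) (AcSelmer.XAc (W.baseChange K) 3 κ 𝔭' ∅ γ)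
  · obtain ⟨F, hF⟩ := exists_map_charIdeal_eq_span (W.baseChange K) κ 𝔭' γ
    have hF0 : F ≠ 0 := by
      intro h0
      apply map_charIdeal_ne_bot (W.baseChange K) κ 𝔭' γ
      rw [hF, h0, Ideal.span_singleton_eq_bot]
    have hdom : RootwiseDominates F L := by
      intro x hx n hFn
      by_cases hc : IsClassicalPoint x
      · rcases Nat.lt_or_ge n 2 with hn | hn
        · interval_cases n
          · exact vanishesToOrder_zero L x
          · exact hA W N K Dt hO6 hsurj hr1 hN hK hH κ hκ γ 𝔭 h𝔭 he hf 𝔭' h𝔭' hne ι' hι ΩK Ωp L hΩK hΩp hL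
              htor F hF x hx hc hFn
        · exact hB W N K Dt hO6 hsurj hr1 hN hK hH κ hκ γ 𝔭 h𝔭 he hf 𝔭' h𝔭' hne ι' hι ΩK Ωp L hΩK hΩp hL
            htor F hF x hx hc n hn hFn
      · exact hC W N K Dt hO6 hsurj hr1 hN hK hH κ hκ γ 𝔭 h𝔭 he hf 𝔭' h𝔭' hne ι' hι ΩK Ωp L hΩK hΩp hL
          htor F hF x hx hc n hFn
    obtain ⟨k, hk⟩ := hR F L hF0 hdom
    exact ⟨k, by rw [hF]; exact hk⟩
  · refine ⟨0, ?_⟩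
    have htop : AcSelmer.XAc.charIdeal (W.baseChange K) 3 κ 𝔭' ∅ γ = ⊤ :=
      Summit.BirchSwinnertonDyer.BirchSwinnertonDyer.Theorems.charIdeal_eq_top_of_not_isTorsion (p := 3) _ htor
    rw [htop, Ideal.map_top]; exact Submodule.mem_top

end Summit.BirchSwinnertonDyer.BirchSwinnertonDyer.Cruxes.RationalSplitIMCInclusionAtThree.RootTrichotomyRankCap
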